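import Summits.HodgeConjecture.HodgeConjecture.Theorems.HeckePrymWeilWeilSixfoldsSqrtMinus7WeilSignatureTyping
import Summits.HodgeConjecture.HodgeConjecture.Theorems.HeckePrymWeilWeilSixfoldsSqrtMinus7WeilSignatureTransport
import Summits.HodgeConjecture.HodgeConjecture.Theorems.HeckePrymWeilAimedDescendingWeilTypeModel
import Summits.HodgeConjecture.HodgeConjecture.Theorems.HeckePrymWeilAimedDescendingRationalModel
import Literature.AlgebraicGeometry.Motives.AbelianVarietyCohomologyExteriorH1
import Literature.AlgebraicGeometry.HodgeTheory.WeilClassesDescendingAssembly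
import HarnessLib

/-!
# Crux `WeilSixfoldsSqrtMinus7` (stmt-HodgeConjecture-1260), line `hyperbolic-eightfold-descent` — sub-goal `stub_weilSignature` (G3) modulo Hodge–Riemann in degree one

Route `HeckePrymWeil`, sub-goal G3 of Stub 7 (aimed partner at `d = 7`). For a complex abelian
`2n`-fold `(A, φ)` with `φ ≫ φ = -7` (`n ≥ 1`) carrying a non-zero rational `(n,n)`-class in its
Weil span, a projective embedding `e` and a rational `a ≠ 0` in `H²(ℙ^{e.n})`, with `K`-symmetrised
hyperplane class `h_A = 7·e^*a + φ^*e^*a`, G3 asks for the RATIONAL DEGREE-ONE MODEL of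
`(A, φ, h_A)` — a rational `ℂ`-basis `u` of `H¹(A(ℂ); ℂ)` on `Fin (4n)`, the rational matrix `M` of
`φ^*`, a non-zero rational top class `ω`, the rational Gram matrix `G` of
`Q_{h_A} = h_A^{2n-1} ∪ · ∪ ·` and `h_A^{2n} = d₀ ω`, with `M² = -7`, `G` alternating and `Mᵀ G M = 7 G`
— TOGETHER WITH THE SIGNATURE `(n, n)`: `M`-stable `2n`-subspaces `P`, `N` of `ℚ^{4n}`,
`P ⊓ N = 0`, with `x ↦ x · G M x` positive definite on `P`, negative definite on `N` (van Geemen,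
LNM 1594, Lemma 5.2 (4)). This file proves:

* `weilModel` — **all model clauses**, from theorems of the tree: `Theorems.exists_rationalModel_one`
  re-indexed by `Fin (4n)` (`b₁ = 2 dim A`, `abelianVarietyCohomologyExteriorH1_holds`);
  `M² = -7` from `(φ^*)² = -7` on `H¹` (`complexBetti_map_map_one_of_comp_self`) in the basis `u`;
  `G` alternating (`Theorems.gram_antisymm`); Weil type (`Theorems.gram_map_eq_mul_gram`) for the
  compatible class `h_A`: `φ^* h_A = 7 h_A` because `(φ ≫ φ)^* = (-7)^*` acts by `49` on
  `H² = ⋀² H¹` (`complexBetti_map_map_two_of_comp_self`);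
* `hodgeRiemannOne_of_neg` — the sign-free degree-one Hodge–Riemann statement for `-h` gives the
  one for `h`;
* `stub_weilSignature_of` — **the registered statement of `stub_weilSignature`, from ONE
  hypothesis**: the sign-free Hodge–Riemann inequality in degree one for `h_A` on `(1,0)`-classes
  (`i · Q_{h_A}(x, x̄) ∈ ℝ_{>0} · ω₀`; Voisin I Thm. 6.32 at `k = 1` for the Kähler class `± h_A` —
  in the tree: the named fact for plain hyperplane classes `e^*a`, `stub_hodgeRiemannOne`, plus the
  re-embedding `7·e^*a + φ^*e^*a = e'^*(t • g)`, `stub_hyperplaneCalculusSym`, glued by the lead).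
  The signature clause is part 3 (`exists_posNeg_of_hodgeRiemannOne`) fed the Weil typing of
  part 2 (`weilTyping`).

Sources: B. van Geemen, LNM 1594 (1994), 4.9, Lemma 5.2 (1)–(6) with proof; C. Voisin, Hodge
Theory I (2002), Thm. 6.32; Ch. Birkenhake, H. Lange, Complex Abelian Varieties, Thm. 4.2.1,
Lemma 1.7.4.
-/

noncomputable section

-- single-problem summit (Problem = Summit): the mandated namespace repeats `HodgeConjecture`.
set_option linter.dupNamespace false

open CategoryTheory Module
open scoped Matrix ComplexConjugate
open Literature.AlgebraicGeometry Literature.AlgebraicGeometry.Motives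
  Literature.AlgebraicGeometry.HodgeTheory Literature.AlgebraicTopology.SingularHomology
  Literature.Geometry.Kaehler

namespace Summit.HodgeConjecture.HodgeConjecture.Theorems.WeilSixfoldsSqrtMinus7.HyperbolicEightfoldDescent

section Model

variable {A : AbelianVariety ℂ}

/-- Rational degree-one model indexed by `Fin m`, `m = dim H¹`. [cite: vanGeemen1994HodgeAV, 4.8 and Lemma 5.2 (2)–(3)] -/
theorem exists_rationalModel_fin (φ : A ⟶ A) {j : ℕ} (hA : A.dim = j + 1) (η : complexBetti A.X 2)
    (hη : IsRationalClass η) {m : ℕ} (hm : Module.finrank ℂ (complexBetti A.X 1) = m) :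
    ∃ (u : Fin m → complexBetti A.X 1) (M : Matrix (Fin m) (Fin m) ℚ)
      (ω : complexBetti A.X (2 + 2 * j)) (G : Matrix (Fin m) (Fin m) ℚ) (d : ℚ),
      (∀ i, IsRationalClass (u i)) ∧ LinearIndependent ℂ u ∧ Submodule.span ℂ (Set.range u) = ⊤ ∧
      (∀ i, complexBetti.map φ.hom.hom.hom 1 (u i) = ∑ k, ((M k i : ℚ) : ℂ) • u k) ∧
      IsRationalClass ω ∧ ω ≠ 0 ∧
      (∀ i k, polarizationPairingOne A.X η j (u i) (u k) = ((G i k : ℚ) : ℂ) • ω) ∧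
      lefschetzPow η j 2 η = ((d : ℚ) : ℂ) • ω := by
  obtain ⟨r, u, M, ω, G, d, hu, hui, husp, hM, hω, hω0, hG, hd⟩ :=
    Theorems.exists_rationalModel_one φ hA η hη
  have hr : r = m := by
    have h := finrank_span_eq_card hui
    rw [husp, finrank_top, hm, Fintype.card_fin] at h
    exact h.symm
  subst hr
  exact ⟨u, M, ω, G, d, hu, hui, husp, hM, hω, hω0, hG, hd⟩

/-- **The model clauses of `stub_weilSignature`** (everything except the signature). [cite: vanGeemen1994HodgeAV, 4.9 and Lemma 5.2 (2)–(3)] -/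
theorem weilModel (n : ℕ) (A : AbelianVariety ℂ) (φ : A ⟶ A) (hn : 1 ≤ n) (hA : A.dim = 2 * n)
    (hφ : φ ≫ φ = -((7 : ℤ) • 𝟙 A)) (e : ProjectiveEmbedding A.X)
    (a : complexBetti (projectiveSpace e.n ℂ) 2) (ha : IsRationalClass a) :
    ∃ (u : Fin (4 * n) → complexBetti A.X 1) (M G : Matrix (Fin (4 * n)) (Fin (4 * n)) ℚ)
      (ω : complexBetti A.X (2 + 2 * (2 * n - 1))) (d₀ : ℚ),
      (∀ i, IsRationalClass (u i)) ∧ LinearIndependent ℂ u ∧ Submodule.span ℂ (Set.range u) = ⊤ ∧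
      (∀ i, complexBetti.map φ.hom.hom.hom 1 (u i) = ∑ k, ((M k i : ℚ) : ℂ) • u k) ∧
      IsRationalClass ω ∧ ω ≠ 0 ∧
      (∀ i k, polarizationPairingOne A.X
          ((7 : ℂ) • complexBetti.map e.ι 2 a + complexBetti.map φ.hom.hom.hom 2 (complexBetti.map e.ι 2 a))
          (2 * n - 1) (u i) (u k) = ((G i k : ℚ) : ℂ) • ω) ∧
      lefschetzPow
          ((7 : ℂ) • complexBetti.map e.ι 2 a + complexBetti.map φ.hom.hom.hom 2 (complexBetti.map e.ι 2 a))
          (2 * n - 1) 2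
          ((7 : ℂ) • complexBetti.map e.ι 2 a + complexBetti.map φ.hom.hom.hom 2 (complexBetti.map e.ι 2 a)) =
        ((d₀ : ℚ) : ℂ) • ω ∧
      (∀ v, M.mulVec (M.mulVec v) = -((7 : ℚ) • v)) ∧
      (∀ x y : Fin (4 * n) → ℚ, y ⬝ᵥ G.mulVec x = -(x ⬝ᵥ G.mulVec y)) ∧
      (∀ x y : Fin (4 * n) → ℚ, M.mulVec x ⬝ᵥ G.mulVec (M.mulVec y) = 7 * (x ⬝ᵥ G.mulVec y)) := by
  classical
  have hφ' : φ ≫ φ = -((7 : ℕ) • 𝟙 A) := by exact_mod_cast hφ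
  have hA' : A.dim = (2 * n - 1) + 1 := by omega
  set H : complexBetti A.X 2 := complexBetti.map e.ι 2 a with hHdef
  set h : complexBetti A.X 2 := (7 : ℂ) • H + complexBetti.map φ.hom.hom.hom 2 H with hhdef
  have hH : IsRationalClass H := ha.map _
  have hh : IsRationalClass h := by
    have h7 := hH.smul 7
    rw [Rat.cast_ofNat] at h7
    exact h7.add (hH.map _)
  have hrank : Module.finrank ℂ (complexBetti A.X 1) = 4 * n := by
    rw [abelianVarietyCohomologyExteriorH1_holds.finrank_one, hA]; ring
  obtain ⟨u, M, ω, G, d₀, hu, hui, husp, hM, hω, hω0, hG, hd⟩ :=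
    exists_rationalModel_fin φ hA' h hh hrank
  -- `φ^* h = 7 h`
  have hφh : complexBetti.map φ.hom.hom.hom 2 h = ((7 : ℕ) : ℂ) • h := by
    rw [hhdef, map_add, map_smul, complexBetti_map_map_two_of_comp_self hφ']
    simp only [Nat.cast_ofNat]
    module
  -- the matrix of `φ^*` squares to `-7`
  let B : Module.Basis (Fin (4 * n)) ℂ (complexBetti A.X 1) := Module.Basis.mk hui (by rw [husp])
  have hB : ∀ i, B i = u i := fun i => Module.Basis.mk_apply hui _ i
  have hTmat : LinearMap.toMatrix B B (complexBetti.map φ.hom.hom.hom 1).hom =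
      M.map (fun q : ℚ => (q : ℂ)) := by
    ext k i
    rw [LinearMap.toMatrix_apply, hB, Matrix.map_apply]
    change B.repr (complexBetti.map φ.hom.hom.hom 1 (u i)) k = _
    rw [hM i]
    simp_rw [← hB]
    rw [B.repr_sum_self]
  have hTT : (complexBetti.map φ.hom.hom.hom 1).hom ∘ₗ (complexBetti.map φ.hom.hom.hom 1).hom =
      (-(7 : ℂ)) • LinearMap.id := LinearMap.ext fun c => by
    rw [LinearMap.comp_apply, LinearMap.smul_apply, LinearMap.id_apply, neg_smul]
    exact_mod_cast complexBetti_map_map_one_of_comp_self hφ' c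
  have hMMC : M.map (fun q : ℚ => (q : ℂ)) * M.map (fun q : ℚ => (q : ℂ)) =
      (-(7 : ℂ)) • (1 : Matrix (Fin (4 * n)) (Fin (4 * n)) ℂ) := by
    rw [← hTmat, ← LinearMap.toMatrix_comp B B B, hTT, LinearEquiv.map_smul, LinearMap.toMatrix_id]
  have hMM : M * M = -((7 : ℚ) • (1 : Matrix (Fin (4 * n)) (Fin (4 * n)) ℚ)) := by
    ext l i
    have hli := congrFun (congrFun hMMC l) i
    simp only [Matrix.mul_apply, Matrix.map_apply, Matrix.smul_apply, Matrix.one_apply, smul_eq_mul,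
      mul_ite, mul_one, mul_zero] at hli
    rw [Matrix.mul_apply, Matrix.neg_apply, Matrix.smul_apply, Matrix.one_apply, smul_eq_mul, mul_ite,
      mul_one, mul_zero]
    have hli' : ((∑ k, M l k * M k i : ℚ) : ℂ) = ((if l = i then -7 else 0 : ℚ) : ℂ) := by
      push_cast
      rw [hli]
      split_ifs <;> simp
    have := (Rat.cast_injective (α := ℂ)) hli'
    rw [this]
    split_ifs <;> simp
  have hMv : ∀ v, M.mulVec (M.mulVec v) = -((7 : ℚ) • v) := fun v => by
    rw [Matrix.mulVec_mulVec, hMM, Matrix.neg_mulVec, Matrix.smul_mulVec, Matrix.one_mulVec]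
  -- alternation
  have hGik : ∀ i k, G i k = -G k i := fun i k => Theorems.gram_antisymm h (2 * n - 1) u hω0 G hG i k
  have hGt : Gᵀ = -G := Matrix.ext fun i k => by
    rw [Matrix.transpose_apply, Matrix.neg_apply]; exact hGik k i
  have hGalt : ∀ x y : Fin (4 * n) → ℚ, y ⬝ᵥ G.mulVec x = -(x ⬝ᵥ G.mulVec y) := fun x y => by
    rw [Matrix.dotProduct_mulVec, ← Matrix.mulVec_transpose, hGt, Matrix.neg_mulVec, neg_dotProduct,
      dotProduct_comm]
  -- Weil type
  have hrk := abelianVarietyCohomologyExteriorH1_holds.finrank_one A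
  have hsp := abelianVarietyCohomologyExteriorH1_holds.span_range_cupPowOne A (2 + 2 * (2 * n - 1))
  have hWik : ∀ i k, ∑ a', ∑ b, M a' i * G a' b * M b k = 7 * G i k := fun i k => by
    have hw := Theorems.gram_map_eq_mul_gram hA' hrk hsp (by norm_num : 0 < 7) hφ' hφh u M hM hω0 G hG i k
    exact_mod_cast hw
  have hMGM : Mᵀ * G * M = (7 : ℚ) • G := by
    ext i k
    rw [Matrix.smul_apply, smul_eq_mul, ← hWik i k, Matrix.mul_apply, Finset.sum_comm]
    refine Finset.sum_congr rfl fun b _ => ?_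
    rw [Matrix.mul_apply, Finset.sum_mul]
    refine Finset.sum_congr rfl fun a' _ => ?_
    rw [Matrix.transpose_apply]
  have hWeil : ∀ x y : Fin (4 * n) → ℚ, M.mulVec x ⬝ᵥ G.mulVec (M.mulVec y) = 7 * (x ⬝ᵥ G.mulVec y) :=
    fun x y => by
    rw [Matrix.mulVec_mulVec, Matrix.dotProduct_mulVec, ← Matrix.vecMul_transpose, Matrix.vecMul_vecMul,
      ← Matrix.mul_assoc, hMGM, ← Matrix.dotProduct_mulVec, Matrix.smul_mulVec, dotProduct_smul,
      smul_eq_mul]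
  exact ⟨u, M, G, ω, d₀, hu, hui, husp, hM, hω, hω0, hG, hd, hMv, hGalt, hWeil⟩

end Model

section Assembly

/-- **Sign symmetry of the Hodge–Riemann hypothesis**: the sign-free degree-one Hodge–Riemann
statement for `-h` implies the one for `h` (`Q_{-h} = (-1)^{2n-1} Q_h = -Q_h`, absorbed by
`ω₀ ↦ -ω₀`); so it is enough to know it for whichever of `± h` is a Kähler class. [folklore] -/
theorem hodgeRiemannOne_of_neg {n : ℕ} (hn : 1 ≤ n) {A : AbelianVariety ℂ} (h : complexBetti A.X 2)
    (hHR : ∃ ω₀ : complexBetti A.X (2 + 2 * (2 * n - 1)), ω₀ ≠ 0 ∧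
      ∀ x : complexBetti A.X 1, IsOfHodgeType (2 * n) A.X 1 1 0 x → x ≠ 0 →
        ∃ r : ℝ, 0 < r ∧ Complex.I • polarizationPairingOne A.X (-h) (2 * n - 1) x
          (conjClass (ComplexPoints A.X) 1 x) = (r : ℂ) • ω₀) :
    ∃ ω₀ : complexBetti A.X (2 + 2 * (2 * n - 1)), ω₀ ≠ 0 ∧
      ∀ x : complexBetti A.X 1, IsOfHodgeType (2 * n) A.X 1 1 0 x → x ≠ 0 →
        ∃ r : ℝ, 0 < r ∧ Complex.I • polarizationPairingOne A.X h (2 * n - 1) x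
          (conjClass (ComplexPoints A.X) 1 x) = (r : ℂ) • ω₀ := by
  obtain ⟨ω₀, hω₀, hH⟩ := hHR
  refine ⟨-ω₀, neg_ne_zero.2 hω₀, fun x hx hx0 => ?_⟩
  obtain ⟨r, hr, hrx⟩ := hH x hx hx0
  refine ⟨r, hr, ?_⟩
  have hodd : Odd (2 * n - 1) := ⟨n - 1, by omega⟩
  rw [show -h = (-1 : ℂ) • h by rw [neg_one_smul], polarizationPairingOne_smul, hodd.neg_one_pow,
    smul_comm, neg_one_smul] at hrx
  rw [smul_neg (r : ℂ) ω₀, ← hrx, neg_neg]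

/-- **`stub_weilSignature` from Hodge–Riemann in degree one.** The model clauses are
`weilModel`; the signature clause is `exists_posNeg_of_hodgeRiemannOne`, fed the Weil typing
(`weilTyping`, PROVED: the non-zero `(n,n)` Weil witness forces `n`-dimensional `(1,0)`-typed
pieces in both eigenspaces `V_{± i√7}` of `φ^*` on `H¹`) and the ONE carrier statement it needs and
the tree lacks: (`hHR`) the sign-free Hodge–Riemann inequality in degree one for the
`K`-symmetrised hyperplane class `h_A = 7·e^*a + φ^*e^*a` on `(1,0)`-classes — Voisin I, Thm. 6.32
at `k = 1` (`i ∫ ω^{2n-1} ∧ α ∧ ᾱ > 0` on `H^{1,0}`) for the Kähler class `± h_A`; the second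
Riemann condition `E(x, Jx) > 0` of van Geemen's proof of Lemma 5.2 (4)–(5).
[cite: vanGeemen1994HodgeAV, 4.9 and Lemma 5.2 (1)–(6) with proof] [cite: VoisinHodgeI2002, Thm. 6.32] -/
theorem stub_weilSignature_of :
    (∀ (n : ℕ) (A : AbelianVariety ℂ) (φ : A ⟶ A), 1 ≤ n → A.dim = 2 * n →
      φ ≫ φ = -((7 : ℤ) • 𝟙 A) →
      ∀ (e : ProjectiveEmbedding A.X) (a : complexBetti (projectiveSpace e.n ℂ) 2),
        IsRationalClass a → a ≠ 0 →
        ∃ ω₀ : complexBetti A.X (2 + 2 * (2 * n - 1)), ω₀ ≠ 0 ∧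
          ∀ x : complexBetti A.X 1, IsOfHodgeType (2 * n) A.X 1 1 0 x → x ≠ 0 →
            ∃ r : ℝ, 0 < r ∧ Complex.I • polarizationPairingOne A.X
              ((7 : ℂ) • complexBetti.map e.ι 2 a +
                complexBetti.map φ.hom.hom.hom 2 (complexBetti.map e.ι 2 a))
              (2 * n - 1) x (conjClass (ComplexPoints A.X) 1 x) = (r : ℂ) • ω₀) →
    ∀ (n : ℕ) (A : AbelianVariety ℂ) (φ : A ⟶ A), 1 ≤ n → A.dim = 2 * n → φ ≫ φ = -((7 : ℤ) • 𝟙 A) →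
      (∃ c : complexBetti A.X (2 * n), c ≠ 0 ∧ IsRationalClass c ∧
        IsOfHodgeType (2 * n) A.X (2 * n) n n c ∧
        c ∈ Module.End.eigenspace (complexBetti.map (𝟙 A + φ).hom.hom.hom (2 * n)).hom
              ((1 + Complex.I * (Real.sqrt (7 : ℝ) : ℂ)) ^ (2 * n)) ⊔
            Module.End.eigenspace (complexBetti.map (𝟙 A + φ).hom.hom.hom (2 * n)).hom
              ((1 - Complex.I * (Real.sqrt (7 : ℝ) : ℂ)) ^ (2 * n))) →
      ∀ (e : ProjectiveEmbedding A.X) (a : complexBetti (projectiveSpace e.n ℂ) 2),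
        IsRationalClass a → a ≠ 0 →
        ∃ (u : Fin (4 * n) → complexBetti A.X 1) (M G : Matrix (Fin (4 * n)) (Fin (4 * n)) ℚ)
          (ω : complexBetti A.X (2 + 2 * (2 * n - 1))) (d₀ : ℚ),
          (∀ i, IsRationalClass (u i)) ∧ LinearIndependent ℂ u ∧ Submodule.span ℂ (Set.range u) = ⊤ ∧
          (∀ i, complexBetti.map φ.hom.hom.hom 1 (u i) = ∑ k, ((M k i : ℚ) : ℂ) • u k) ∧
          IsRationalClass ω ∧ ω ≠ 0 ∧
          (∀ i k, polarizationPairingOne A.X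
              ((7 : ℂ) • complexBetti.map e.ι 2 a + complexBetti.map φ.hom.hom.hom 2 (complexBetti.map e.ι 2 a))
              (2 * n - 1) (u i) (u k) = ((G i k : ℚ) : ℂ) • ω) ∧
          lefschetzPow
              ((7 : ℂ) • complexBetti.map e.ι 2 a + complexBetti.map φ.hom.hom.hom 2 (complexBetti.map e.ι 2 a))
              (2 * n - 1) 2
              ((7 : ℂ) • complexBetti.map e.ι 2 a + complexBetti.map φ.hom.hom.hom 2 (complexBetti.map e.ι 2 a)) =
            ((d₀ : ℚ) : ℂ) • ω ∧
          (∀ v, M.mulVec (M.mulVec v) = -((7 : ℚ) • v)) ∧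
          (∀ x y : Fin (4 * n) → ℚ, y ⬝ᵥ G.mulVec x = -(x ⬝ᵥ G.mulVec y)) ∧
          (∀ x y : Fin (4 * n) → ℚ, M.mulVec x ⬝ᵥ G.mulVec (M.mulVec y) = 7 * (x ⬝ᵥ G.mulVec y)) ∧
          ∃ P N : Submodule ℚ (Fin (4 * n) → ℚ),
            (∀ v ∈ P, M.mulVec v ∈ P) ∧ (∀ v ∈ N, M.mulVec v ∈ N) ∧
            Module.finrank ℚ P = 2 * n ∧ Module.finrank ℚ N = 2 * n ∧ P ⊓ N = ⊥ ∧
            (∀ x ∈ P, x ≠ 0 → 0 < x ⬝ᵥ G.mulVec (M.mulVec x)) ∧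
            (∀ x ∈ N, x ≠ 0 → x ⬝ᵥ G.mulVec (M.mulVec x) < 0) := by
  intro hHR n A φ hn hA hφ hwit e a ha ha0
  obtain ⟨u, M, G, ω, d₀, hu, hui, husp, hM, hω, hω0, hG, hd, hMv, hGalt, hWeil⟩ :=
    weilModel n A φ hn hA hφ e a ha
  obtain ⟨P, N, hP, hN, hPf, hNf, hPN, hpos, hneg⟩ :=
    exists_posNeg_of_hodgeRiemannOne n A φ _ u M G ω hn hA hu hui husp hM hω0 hG hMv hGalt hWeil
      (hHR n A φ hn hA hφ e a ha ha0) (weilTyping n A φ hn hA hφ hwit)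
  exact ⟨u, M, G, ω, d₀, hu, hui, husp, hM, hω, hω0, hG, hd, hMv, hGalt, hWeil, P, N, hP, hN, hPf,
    hNf, hPN, hpos, hneg⟩

end Assembly

end Summit.HodgeConjecture.HodgeConjecture.Theorems.WeilSixfoldsSqrtMinus7.HyperbolicEightfoldDescent

end
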